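import Literature.Computability.Cryptography.KitaevPhaseEstimationSums
import Mathlib.Analysis.Complex.Norm
import HarnessLib

/-!
# The AJL sampler: decision rule, Chebyshev bound, completeness and soundness

Topic `Literature/Computability/QuantumComplexity`; a step towards the named fact
`ajl_mem_PromiseBQPOver_ajlGateSet` (S2 of the decomposition of `ajl_jonesApproxProblem_mem_PromiseBQP`,
`JonesInBQPProofs.lean`): the *probabilistic* part of Algorithm Approximate-Jones-Plat-Closure of
D. Aharonov, V. Jones, Z. Landau (arXiv:quant-ph/0511096, §3.3, with §2.2), in the threshold form
decided by the tree's promise problem `jonesApproxProblem` (`JonesPolynomial.lean`: YES if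
`|V|/d^{n/2-1} ≥ θ + 1/prec`, NO if `≤ θ`).

AJL (§3.3): "for `j = 1` to `poly(n, m, k)`: output a random variable `x_j ∈ {-1, 1}` whose expectation
is `Re⟨α|Q(B)|α⟩` [a Hadamard test, §2.2]; do the same for `y_j` with expectation `Im⟨α|Q(B)|α⟩`;
let `r` be the average over all `x_j + i y_j`"; Thm. 3.2: `⟨α|Q|α⟩ = ⟨B^{pl}⟩/d^{n/2-1}`; Claim 3.3: "it
suffices to approximate each of the variables to within an additive error `ε` … exponentially small
probability to fail, using the Chernoff–Hoeffding bound". Here the unknown is one complex number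
`z = ⟨α|Q|α⟩` with `|z| ≤ 1` (a diagonal entry of a unitary), the `K` real-part tests read `1` with
probability `(1 - Re z)/2` each and the `K` imaginary-part tests with probability `(1 - Im z)/2`
(`HadamardTest.lean`: `hadamardTest_prob`, `hadamardTest_prob_im`), independently, and we prove the
error bound for the *threshold* decision with Chebyshev's inequality (enough for error `1/3`; the
tree's `Literature.Computability.Cryptography.Kitaev1995.chebyshev_block`) and `K = O(prec²)` repetitions:

* `AJLSampler.Trial K = Bool × Fin K` (type of test × repetition), `testProb z t c`, the product
  weight `weight z γ` of an outcome `γ : Trial K → Bool` (a probability distribution,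
  `sum_weight`), the counts `count t γ` of ones per type;
* the decision rule `AJLSampler.accept θn θd prec K cR cI` (exact, over `ℚ`): with the empirical
  means `r_R = 1 - 2 cR/K`, `r_I = 1 - 2 cI/K` accept iff `(θ + 1/(2·prec))² ≤ r_R² + r_I²`
  (`θ = θn/θd`), i.e. iff `|r| ≥ θ + 1/(2·prec)` (`accept_iff_le_norm`); `acceptProb z θn θd prec K`;
* `weight_deviation_le` (Chebyshev per type: deviation `≥ a` of a count from its mean has weight
  `≤ K/(4a²)`), `norm_cEstimate_sub_lt` (both counts within `K/(8·prec)` of their means ⇒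
  `|r - z| < 1/(2·prec)` for the complex empirical mean `r = cEstimate K cR cI`), `pr_not_good_le`
  (failure weight `≤ 32 prec²/K ≤ 1/3` for `K ≥ 96 prec²`; `pr z E` is the weight of an event);
* **`acceptProb_ge_of_yes`**: `96 prec² ≤ K`, `|z| ≤ 1`, `θ + 1/prec ≤ |z|` ⇒ `acceptProb ≥ 2/3`;
  **`acceptProb_le_of_no`**: `96 prec² ≤ K`, `|z| ≤ 1`, `|z| ≤ θ` ⇒ `acceptProb ≤ 1/3`
  (AJL Claim 3.3 / Thm. 3.2 in threshold form, with Chebyshev in place of Chernoff–Hoeffding).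

## References

* D. Aharonov, V. Jones, Z. Landau, *A polynomial quantum algorithm for approximating the Jones
  polynomial*, Algorithmica 55 (2009) = arXiv:quant-ph/0511096, §2.2, §3.3 (Algorithm
  Approximate-Jones-Plat-Closure, Claim 3.3, Thm. 3.2) [AharonovJonesLandau2009].
* A. Yu. Kitaev, arXiv:quant-ph/9511026 (1995), §3 (Chebyshev estimate before Lemma 9) — the tree's
  `chebyshev_block` [Kitaev1995].

## Design notes

* Chernoff–Hoeffding (as in AJL) would give exponentially small error with `K = O(prec² log)`; the
  class `PromiseBQPOver` only asks for error `≤ 1/3`, for which Chebyshev with `K = 96 prec²`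
  suffices, and the tree already has the product-weight Chebyshev inequality.
* The decision rule compares squares of rationals, so that the classical post-processing is exact
  integer arithmetic; `accept_iff_le_norm` translates it to `θ + 1/(2·prec) ≤ |r|`.
-/

noncomputable section

open Finset Complex

namespace Literature.Computability.QuantumComplexity

namespace AJLSampler

/-- Labels of the Hadamard tests of one run of the sampler: type (`false` = real-part test,
`true` = imaginary-part test) and repetition index. [cite: AharonovJonesLandau2009, §3.3 (the variables `x_j`, `y_j`)] -/
abbrev Trial (K : ℕ) : Type := Bool × Fin K

variable {K : ℕ}

/-- The `±1` value of an outcome bit (`0 ↦ 1`, `1 ↦ -1`). [cite: AharonovJonesLandau2009, §2.2] -/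
def sgn (c : Bool) : ℝ := if c then -1 else 1

/-- The probability that a test of type `t` reads `c` when the estimated diagonal entry is `z`:
`(1 ± Re z)/2` for real-part tests, `(1 ± Im z)/2` for imaginary-part tests (`+` for `c = 0`).
[cite: AharonovJonesLandau2009, §2.2] -/
def testProb (z : ℂ) (t c : Bool) : ℝ := (1 + sgn c * (if t then z.im else z.re)) / 2

/-- The weight (probability) of a complete outcome `γ` of the `2K` independent tests.
[cite: AharonovJonesLandau2009, §3.3] -/
def weight (z : ℂ) (γ : Trial K → Bool) : ℝ := ∏ j, testProb z j.1 (γ j)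

/-- The block of tests of type `t`. [folklore] -/
def block (K : ℕ) (t : Bool) : Finset (Trial K) := univ.map (Function.Embedding.sectR t (Fin K))

/-- The number of tests of type `t` reading `1` in the outcome `γ`. [cite: AharonovJonesLandau2009, §3.3 (the average `r`)] -/
def count (t : Bool) (γ : Trial K → Bool) : ℕ := ((block K t).filter fun j => γ j = true).card

/-- The empirical mean of the `±1` values of `K` tests of which `c` read `1`: `1 - 2c/K`.
[cite: AharonovJonesLandau2009, §3.3] -/
def estimate (K c : ℕ) : ℝ := 1 - 2 * (c : ℝ) / K

/-- **The decision rule** of the threshold form of Algorithm Approximate-Jones-Plat-Closure: with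
`θ = θn/θd`, the empirical means `r_R = 1 - 2cR/K`, `r_I = 1 - 2cI/K`, accept iff
`(θ + 1/(2·prec))² ≤ r_R² + r_I²` (exact rational arithmetic). [cite: AharonovJonesLandau2009, §3.3 and Claim 3.3] -/
def accept (θn θd prec K cR cI : ℕ) : Bool :=
  decide (((θn : ℚ) / θd + 1 / (2 * prec)) ^ 2 ≤ (1 - 2 * (cR : ℚ) / K) ^ 2 + (1 - 2 * (cI : ℚ) / K) ^ 2)

/-- The acceptance probability of the sampler: total weight of the accepted outcomes.
[cite: AharonovJonesLandau2009, §3.3] -/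
def acceptProb (z : ℂ) (θn θd prec K : ℕ) : ℝ :=
  ∑ γ : Trial K → Bool, if accept θn θd prec K (count false γ) (count true γ) then weight z γ else 0

/-! ### The weights are a probability distribution -/

/-- `|Re z|, |Im z| ≤ 1` when `|z| ≤ 1`. [folklore] -/
theorem abs_part_le_one {z : ℂ} (hz : ‖z‖ ≤ 1) (t : Bool) : |(if t then z.im else z.re)| ≤ 1 := by
  cases t
  · exact (abs_re_le_norm z).trans hz
  · exact (abs_im_le_norm z).trans hz

/-- Test probabilities are nonnegative (`|z| ≤ 1`). [folklore] -/
theorem testProb_nonneg {z : ℂ} (hz : ‖z‖ ≤ 1) (t c : Bool) : 0 ≤ testProb z t c := by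
  have h := abs_part_le_one hz t
  rw [abs_le] at h
  unfold testProb sgn
  cases c <;> simp only [if_true, if_false, Bool.false_eq_true] <;> linarith [h.1, h.2]

/-- Test probabilities are at most `1` (`|z| ≤ 1`). [folklore] -/
theorem testProb_le_one {z : ℂ} (hz : ‖z‖ ≤ 1) (t c : Bool) : testProb z t c ≤ 1 := by
  have h := abs_part_le_one hz t
  rw [abs_le] at h
  unfold testProb sgn
  cases c <;> simp only [if_true, if_false, Bool.false_eq_true] <;> linarith [h.1, h.2]

/-- The two outcomes of a test have total probability `1`. [folklore] -/
theorem testProb_add (z : ℂ) (t : Bool) : testProb z t false + testProb z t true = 1 := by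
  unfold testProb sgn
  simp only [if_false, if_true, Bool.false_eq_true]
  ring

/-- Weights are nonnegative (`|z| ≤ 1`). [folklore] -/
theorem weight_nonneg {z : ℂ} (hz : ‖z‖ ≤ 1) (γ : Trial K → Bool) : 0 ≤ weight z γ :=
  prod_nonneg fun j _ => testProb_nonneg hz j.1 (γ j)

/-- **The weights sum to one.** [folklore] -/
theorem sum_weight (z : ℂ) : ∑ γ : Trial K → Bool, weight z γ = 1 := by
  have h := Literature.Computability.Cryptography.Kitaev1995.sum_prodWeight (fun (j : Trial K) c => testProb z j.1 c) fun j => testProb_add z j.1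
  simpa only [weight] using h

/-- The block of type `t` has `K` tests. [folklore] -/
theorem card_block (K : ℕ) (t : Bool) : (block K t).card = K := by
  simp [block]

/-- The mean number of ones in the block of type `t` is `K · p_t`. [folklore] -/
theorem sum_block_testProb (z : ℂ) (t : Bool) :
    ∑ j ∈ block K t, testProb z j.1 true = K * testProb z t true := by
  rw [block, sum_map]
  simp [Function.Embedding.sectR]

/-! ### Probabilities of events -/

/-- The weight of an event. [folklore] -/
def pr (z : ℂ) (E : (Trial K → Bool) → Prop) [DecidablePred E] : ℝ :=
  ∑ γ : Trial K → Bool, if E γ then weight z γ else 0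

/-- Monotonicity of event weights. [folklore] -/
theorem pr_mono {z : ℂ} (hz : ‖z‖ ≤ 1) {E F : (Trial K → Bool) → Prop} [DecidablePred E] [DecidablePred F]
    (h : ∀ γ, E γ → F γ) : pr z E ≤ pr z F := by
  refine sum_le_sum fun γ _ => ?_
  by_cases hE : E γ
  · rw [if_pos hE, if_pos (h γ hE)]
  · rw [if_neg hE]
    split_ifs
    · exact weight_nonneg hz γ
    · exact le_rfl

/-- Union bound. [folklore] -/
theorem pr_or_le {z : ℂ} (hz : ‖z‖ ≤ 1) (E F : (Trial K → Bool) → Prop) [DecidablePred E] [DecidablePred F] :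
    pr z (fun γ => E γ ∨ F γ) ≤ pr z E + pr z F := by
  unfold pr
  rw [← sum_add_distrib]
  refine sum_le_sum fun γ _ => ?_
  have hw := weight_nonneg hz γ
  by_cases hE : E γ <;> by_cases hF : F γ <;> simp [hE, hF, hw]

/-- Complementary events. [folklore] -/
theorem pr_add_pr_not (z : ℂ) (E : (Trial K → Bool) → Prop) [DecidablePred E] :
    pr z E + pr z (fun γ => ¬ E γ) = 1 := by
  unfold pr
  rw [← sum_add_distrib, ← sum_weight (K := K) z]
  refine sum_congr rfl fun γ _ => ?_
  by_cases hE : E γ <;> simp [hE]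

/-- Event weights are at most `1`. [folklore] -/
theorem pr_le_one {z : ℂ} (hz : ‖z‖ ≤ 1) (E : (Trial K → Bool) → Prop) [DecidablePred E] : pr z E ≤ 1 := by
  have h := pr_add_pr_not (K := K) z E
  have h' : 0 ≤ pr z (fun γ => ¬ E γ) := sum_nonneg fun γ _ => by
    split_ifs
    · exact weight_nonneg hz γ
    · exact le_rfl
  linarith

/-! ### Chebyshev per type -/

/-- **Chebyshev's inequality for the tests of one type**: the outcomes whose number of ones of
type `t` deviates from its mean `K p_t` by at least `a > 0` have weight `≤ K/(4a²)`.
[cite: Kitaev1995, §3 (Lemma 9)] -/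
theorem weight_deviation_le {z : ℂ} (hz : ‖z‖ ≤ 1) (t : Bool) {a : ℝ} (ha : 0 < a) :
    pr z (fun γ : Trial K → Bool => a ≤ |(count t γ : ℝ) - K * testProb z t true|) ≤ K / (4 * a ^ 2) := by
  have h := Literature.Computability.Cryptography.Kitaev1995.chebyshev_block (fun (j : Trial K) c => testProb z j.1 c)
    (fun j c => testProb_nonneg hz j.1 c) (fun j => testProb_add z j.1) (block K t) ha
  rw [sum_block_testProb, card_block] at h
  unfold pr
  rw [← sum_filter]
  exact h

/-! ### Accuracy of the estimates on the good event -/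

/-- If the count is within `a` of its mean then the empirical mean is within `2a/K` of the
estimated quantity (`E[1 - 2c/K] = Re z` resp. `Im z`). [cite: AharonovJonesLandau2009, §2.2 and §3.3] -/
theorem abs_estimate_sub_lt {z : ℂ} (t : Bool) (hK : 0 < K) {c : ℕ} {a : ℝ}
    (h : |(c : ℝ) - K * testProb z t true| < a) :
    |estimate K c - (if t then z.im else z.re)| < 2 * a / K := by
  have hK' : (0 : ℝ) < K := by exact_mod_cast hK
  have key : estimate K c - (if t then z.im else z.re) = -(2 / K) * ((c : ℝ) - K * testProb z t true) := by
    unfold estimate testProb sgn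
    simp only [if_true]
    field_simp
    ring
  rw [key, abs_mul, abs_neg, abs_of_pos (by positivity : (0 : ℝ) < 2 / K)]
  calc 2 / (K : ℝ) * |(c : ℝ) - K * testProb z t true| < 2 / K * a :=
        mul_lt_mul_of_pos_left h (by positivity)
    _ = 2 * a / K := by ring

/-- The complex empirical mean `r = r_R + i r_I`. [cite: AharonovJonesLandau2009, §3.3] -/
def cEstimate (K cR cI : ℕ) : ℂ := ⟨estimate K cR, estimate K cI⟩

/-- **On the good event the estimate is close**: if both counts are within `K/(8·prec)` of their
means then `|r - z| < 1/(2·prec)`. [cite: AharonovJonesLandau2009, Claim 3.3] -/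
theorem norm_cEstimate_sub_lt {z : ℂ} (hK : 0 < K) {prec : ℕ} (hprec : 0 < prec) {cR cI : ℕ}
    (hR : |(cR : ℝ) - K * testProb z false true| < K / (8 * prec))
    (hI : |(cI : ℝ) - K * testProb z true true| < K / (8 * prec)) :
    ‖cEstimate K cR cI - z‖ < 1 / (2 * prec) := by
  have hK' : (0 : ℝ) < K := by exact_mod_cast hK
  have hp' : (0 : ℝ) < prec := by exact_mod_cast hprec
  have h1 := abs_estimate_sub_lt (z := z) false hK hR
  have h2 := abs_estimate_sub_lt (z := z) true hK hI
  simp only [if_false, if_true, Bool.false_eq_true] at h1 h2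
  have h3 : 2 * ((K : ℝ) / (8 * prec)) / K = 1 / (4 * prec) := by field_simp; ring
  rw [h3] at h1 h2
  calc ‖cEstimate K cR cI - z‖ ≤ |(cEstimate K cR cI - z).re| + |(cEstimate K cR cI - z).im| :=
        norm_le_abs_re_add_abs_im _
    _ = |estimate K cR - z.re| + |estimate K cI - z.im| := by simp [cEstimate]
    _ < 1 / (4 * prec) + 1 / (4 * prec) := add_lt_add h1 h2
    _ = 1 / (2 * prec) := by field_simp; ring

/-- The squared modulus of the complex estimate. [folklore] -/
theorem sq_norm_cEstimate (K cR cI : ℕ) :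
    ‖cEstimate K cR cI‖ ^ 2 = estimate K cR ^ 2 + estimate K cI ^ 2 := by
  rw [Complex.sq_norm, cEstimate, normSq_mk]; ring

/-- **The decision rule accepts iff `θ + 1/(2·prec) ≤ |r|`.** [cite: AharonovJonesLandau2009, §3.3] -/
theorem accept_iff_le_norm (θn θd prec K cR cI : ℕ) :
    accept θn θd prec K cR cI = true ↔ (θn : ℝ) / θd + 1 / (2 * prec) ≤ ‖cEstimate K cR cI‖ := by
  have h0 : (0 : ℝ) ≤ (θn : ℝ) / θd + 1 / (2 * prec) := by positivity
  rw [← pow_le_pow_iff_left₀ h0 (norm_nonneg _) two_ne_zero, sq_norm_cEstimate, accept, decide_eq_true_iff]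
  unfold estimate
  constructor
  · intro h
    have h' := (Rat.cast_le (K := ℝ)).2 h
    push_cast at h'
    exact h'
  · intro h
    have h' : (((θn : ℚ) / θd + 1 / (2 * prec)) ^ 2 : ℚ) ≤
        ((1 - 2 * (cR : ℚ) / K) ^ 2 + (1 - 2 * (cI : ℚ) / K) ^ 2 : ℚ) := by
      rw [← Rat.cast_le (K := ℝ)]
      push_cast
      exact h
    exact h'

/-! ### The good event and its probability -/

/-- The good event: both counts are within `K/(8·prec)` of their means. [cite: AharonovJonesLandau2009, Claim 3.3] -/
def Good (z : ℂ) (prec K : ℕ) (γ : Trial K → Bool) : Prop :=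
  |(count false γ : ℝ) - K * testProb z false true| < K / (8 * prec) ∧
    |(count true γ : ℝ) - K * testProb z true true| < K / (8 * prec)

/-- The good event is decidable (two real inequalities, classically). [folklore] -/
instance instDecidablePredGood (z : ℂ) (prec K : ℕ) : DecidablePred (Good z prec K) := fun _ => by
  unfold Good; infer_instance

/-- **The bad event has weight at most `1/3`** when `K ≥ 96 prec²` (Chebyshev twice and a union
bound: `2 · 16 prec²/K`). [cite: AharonovJonesLandau2009, Claim 3.3] [cite: Kitaev1995, §3 (Lemma 9)] -/
theorem pr_not_good_le {z : ℂ} (hz : ‖z‖ ≤ 1) {prec : ℕ} (hprec : 0 < prec) (hK : 96 * prec ^ 2 ≤ K) :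
    pr z (fun γ : Trial K → Bool => ¬ Good z prec K γ) ≤ 1 / 3 := by
  have hp' : (0 : ℝ) < prec := by exact_mod_cast hprec
  have hKpos : 0 < K := by
    have : 0 < 96 * prec ^ 2 := by positivity
    omega
  have hK' : (0 : ℝ) < K := by exact_mod_cast hKpos
  have hKr : (96 : ℝ) * prec ^ 2 ≤ K := by exact_mod_cast hK
  set a : ℝ := K / (8 * prec) with ha_def
  have ha : 0 < a := by positivity
  have hR := weight_deviation_le (K := K) hz false ha
  have hI := weight_deviation_le (K := K) hz true ha
  have hval : (K : ℝ) / (4 * a ^ 2) = 16 * prec ^ 2 / K := by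
    rw [ha_def]; field_simp; ring
  rw [hval] at hR hI
  calc pr z (fun γ : Trial K → Bool => ¬ Good z prec K γ)
      ≤ pr z (fun γ : Trial K → Bool => a ≤ |(count false γ : ℝ) - K * testProb z false true| ∨
          a ≤ |(count true γ : ℝ) - K * testProb z true true|) := by
        refine pr_mono hz fun γ hγ => ?_
        unfold Good at hγ
        rw [not_and_or, not_lt, not_lt] at hγ
        exact hγ
    _ ≤ 16 * prec ^ 2 / K + 16 * prec ^ 2 / K := (pr_or_le hz _ _).trans (add_le_add hR hI)
    _ = 32 * prec ^ 2 / K := by ring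
    _ ≤ 1 / 3 := by
        rw [div_le_div_iff₀ hK' (by norm_num : (0 : ℝ) < 3)]
        linarith

/-- The good event has weight at least `2/3` when `K ≥ 96 prec²`. [cite: AharonovJonesLandau2009, Claim 3.3] -/
theorem pr_good_ge {z : ℂ} (hz : ‖z‖ ≤ 1) {prec : ℕ} (hprec : 0 < prec) (hK : 96 * prec ^ 2 ≤ K) :
    2 / 3 ≤ pr z (Good z prec K) := by
  have h1 := pr_add_pr_not (K := K) z (Good z prec K)
  have h2 := pr_not_good_le hz hprec hK
  linarith

/-! ### Completeness and soundness -/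

/-- **Completeness** (AJL Claim 3.3 with Thm. 3.2, threshold form): if `|z| ≥ θ + 1/prec` (and
`|z| ≤ 1`, `K ≥ 96 prec²`) the sampler accepts with probability `≥ 2/3`: on the good event
`|r| > |z| - 1/(2·prec) ≥ θ + 1/(2·prec)`. [cite: AharonovJonesLandau2009, §3.3, Claim 3.3 and Thm. 3.2] -/
theorem acceptProb_ge_of_yes {z : ℂ} (hz : ‖z‖ ≤ 1) {θn θd prec K : ℕ} (hprec : 0 < prec)
    (hK : 96 * prec ^ 2 ≤ K) (hyes : (θn : ℝ) / θd + 1 / prec ≤ ‖z‖) :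
    2 / 3 ≤ acceptProb z θn θd prec K := by
  have hp' : (0 : ℝ) < prec := by exact_mod_cast hprec
  have hKpos : 0 < K := by
    have : 0 < 96 * prec ^ 2 := by positivity
    omega
  refine (pr_good_ge hz hprec hK).trans (pr_mono hz fun γ hγ => ?_)
  rw [accept_iff_le_norm]
  have hclose := norm_cEstimate_sub_lt hKpos hprec hγ.1 hγ.2
  have htri : ‖z‖ - ‖cEstimate K (count false γ) (count true γ)‖ ≤
      ‖cEstimate K (count false γ) (count true γ) - z‖ := by
    rw [← norm_neg (cEstimate K (count false γ) (count true γ) - z), neg_sub]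
    exact norm_sub_norm_le _ _
  have h12 : (1 : ℝ) / prec - 1 / (2 * prec) = 1 / (2 * prec) := by field_simp; ring
  linarith

/-- **Soundness**: if `|z| ≤ θ` (and `|z| ≤ 1`, `K ≥ 96 prec²`) the sampler accepts with probability
`≤ 1/3`: on the good event `|r| < |z| + 1/(2·prec) ≤ θ + 1/(2·prec)`. [cite: AharonovJonesLandau2009, §3.3, Claim 3.3 and Thm. 3.2] -/
theorem acceptProb_le_of_no {z : ℂ} (hz : ‖z‖ ≤ 1) {θn θd prec K : ℕ} (hprec : 0 < prec)
    (hK : 96 * prec ^ 2 ≤ K) (hno : ‖z‖ ≤ (θn : ℝ) / θd) :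
    acceptProb z θn θd prec K ≤ 1 / 3 := by
  have hKpos : 0 < K := by
    have : 0 < 96 * prec ^ 2 := by positivity
    omega
  refine le_trans (pr_mono hz fun γ hγ => ?_) (pr_not_good_le hz hprec hK)
  intro hgood
  rw [accept_iff_le_norm] at hγ
  have hclose := norm_cEstimate_sub_lt hKpos hprec hgood.1 hgood.2
  have htri : ‖cEstimate K (count false γ) (count true γ)‖ - ‖z‖ ≤
      ‖cEstimate K (count false γ) (count true γ) - z‖ := norm_sub_norm_le _ _
  linarith

/-- Acceptance probabilities lie in `[0, 1]`. [folklore] -/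
theorem acceptProb_mem_Icc {z : ℂ} (hz : ‖z‖ ≤ 1) (θn θd prec K : ℕ) :
    acceptProb z θn θd prec K ∈ Set.Icc (0 : ℝ) 1 :=
  ⟨sum_nonneg fun γ _ => by split_ifs <;> [exact weight_nonneg hz γ; exact le_rfl], pr_le_one hz _⟩

end AJLSampler

end Literature.Computability.QuantumComplexity

end
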